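import Literature.AlgebraicGeometry.Motives.HodgeLieComplexCenter
import HarnessLib

/-!
# The `ad(2P − 1)`-grading `𝔥_ℂ = 𝔥⁻ ⊕ 𝔥⁰ ⊕ 𝔥⁺` of the Hodge Lie algebra of a weight-one Hodge structure:
# the three eigenspaces of `ad P`, their multiplication table, and the dimension count

Family `hodge`, layer `Literature/AlgebraicGeometry/Motives`; THEOREMS ONLY (no definition, no named fact; D-0026).
First abstract file of the lane MT-RANK-SEVEN-SIMPLE of the cell `pub-hodgecm2` (COR-CM), seat `b27` gen 40 — the
`ℚ`-SIMPLE branch of the rung `dim MT(H¹X) = 7` (`Summits/HodgeConjecture/CorCM/MumfordTateRankSevenSemisimple`).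

SETTING.  `H` of weight `1`, graded basis `e` with degrees in `{0,1}`, `P = gradingEnd e deg` (the projector onto
`V^{1,0}` along `V^{0,1}`), `𝔤 = 𝔥_ℂ = H.hodgeLieC`.  The inner derivation `ad P = (Y ↦ PY − YP)` of `End_ℂ(V_ℂ)`,
written `LinearMap.mulLeft ℂ P − LinearMap.mulRight ℂ P`, has the three eigenvalues `1, −1, 0` with eigenspaces
`P·End·(1−P)`, `(1−P)·End·P` and the block-diagonal operators; since `2P − 1 ∈ 𝔤` (the Hodge operator) these cut
`𝔤` into **`𝔤⁺ = 𝔤 ⊓ Eig₁`, `𝔤⁻ = 𝔤 ⊓ Eig₋₁`, `𝔤⁰ = 𝔤 ⊓ Eig₀`** — the root-space grading of `𝔤` by the Hodge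
cocharacter (Deligne I §3: `ad μ(z)` acts on `Lie(MT)_ℂ` with weights `z/z̄, 1, z̄/z` in weight one).

* §1 (any idempotent `P`, any field) `mem_eigenspace_adP_one_iff` & co — membership in the three eigenspaces as the
  identities `P Y (1−P) = Y`, `(1−P) Y P = Y`, `P Y = Y P`; the three components of any `Y`; the multiplication
  table: `Eig₁ · Eig₁ = 0 = Eig₋₁ · Eig₋₁`, `Eig₀ · Eig_{±1}, Eig_{±1} · Eig₀ ⊆ Eig_{±1}`, `Eig₁ · Eig₋₁ ⊆ Eig₀`, and
  `E F' = F' E ⟹ E F' = 0 = F' E` (a `P`-corner equal to a `(1−P)`-corner).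
* §2 `hodgeLieC_components_mem` — for `Y ∈ 𝔤` all three components lie in `𝔤` (`projE_mem_hodgeLieC`);
  **`finrank_hodgeLieC_eq_grading`**: `dim 𝔤 = dim 𝔤⁺ + dim 𝔤⁻ + dim 𝔤⁰`.

The sequel `Motives/HodgeLieWeightOneGradingSymmetry` adds the conjugation symmetry `dim 𝔤⁺ = dim 𝔤⁻`, the elements
`2P − 1 ∈ 𝔤⁰`, `E_X ∈ 𝔤⁺`, `F_X ∈ 𝔤⁻`, the dichotomy `(dim 𝔤⁺, dim 𝔤⁻, dim 𝔤⁰) ∈ {(1,1,4), (2,2,2)}` at `dim 𝔥 = 6`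
and the link with `Motives/HodgeLieWeightOnePlusLine`; `Motives/HodgeLieWeightOneGradingTwo` treats `dim 𝔤⁺ = 2`.

## References

* [Deligne1982HodgeCycles] P. Deligne, *Hodge cycles on abelian varieties*, LNM 900 (1982), I §3 (proof of Prop. 3.4,
  3.6: the grading of `Lie MT_ℂ` by `ad μ`).
* [MoonenZarhin1999LowDim] B. Moonen, Yu. Zarhin, *Hodge classes on abelian varieties of low dimension*, Math. Ann. 315
  (1999), §2 (Hodge group, `Hg ⊆ Sp(ψ)`, (2.3)).
* [Huybrechts2016K3] D. Huybrechts, *Lectures on K3 Surfaces* (2016), §3.3.4 (p. 66).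
-/

noncomputable section

open scoped TensorProduct

namespace Literature.AlgebraicGeometry.Motives

universe u

namespace HodgeStructure

open ProjectorBlocks Literature.RepresentationTheory.GeneralLinear

/-! ## §1 The three eigenspaces of `ad P` for an idempotent `P` -/

section Generic

variable {K : Type*} [Field K] [CharZero K] {W : Type*} [AddCommGroup W] [Module K W]

omit [CharZero K] in
/-- `(ad P) Y = P Y − Y P`. [cite: Deligne1982HodgeCycles, I §3 (proof of Prop. 3.4)] -/
theorem adP_apply (P Y : Module.End K W) :
    (LinearMap.mulLeft K P - LinearMap.mulRight K P) Y = P * Y - Y * P := by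
  rw [LinearMap.sub_apply, LinearMap.mulLeft_apply, LinearMap.mulRight_apply]

/-- **`Y ∈ Eig₁(ad P) ↔ P Y (1 − P) = Y`** (`P² = P`, characteristic `0`). [cite: Deligne1982HodgeCycles, I §3 (proof of Prop. 3.4)] -/
theorem mem_eigenspace_adP_one_iff {P : Module.End K W} (hPP : P * P = P) (Y : Module.End K W) :
    Y ∈ Module.End.eigenspace (LinearMap.mulLeft K P - LinearMap.mulRight K P) 1 ↔ P * Y * (1 - P) = Y := by
  have nf : ∀ X : Module.End K W, P * (P * X) = P * X := fun X => by rw [← mul_assoc, hPP]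
  rw [Module.End.mem_eigenspace_iff, adP_apply, one_smul]
  constructor
  · intro h
    have h1 : P * (Y * P) = 0 := by
      have h' := congrArg (fun T => P * T * P) h
      simp only [mul_sub, sub_mul, mul_assoc, hPP, nf, sub_self] at h'
      exact h'.symm
    have h2 : Y * P = 0 := by
      have h' := congrArg (fun T => T * P) h
      simp only [sub_mul, mul_assoc, hPP, h1, zero_sub] at h'
      -- h' : -(Y * P) = Y * P
      have h'' : (2 : K) • (Y * P) = 0 := by
        rw [two_smul]; nth_rw 1 [← h']; rw [neg_add_cancel]
      exact (smul_eq_zero.1 h'').resolve_left two_ne_zero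
    have h3 : P * Y = Y := by rw [← sub_zero (P * Y), ← h2]; exact h
    rw [mul_sub, mul_one, h3, h2, sub_zero]
  · intro h
    rw [← h]
    simp only [mul_sub, sub_mul, mul_one, mul_assoc, hPP, nf]
    abel

/-- **`Y ∈ Eig₋₁(ad P) ↔ (1 − P) Y P = Y`** (`P² = P`, characteristic `0`). [cite: Deligne1982HodgeCycles, I §3 (proof of Prop. 3.4)] -/
theorem mem_eigenspace_adP_neg_one_iff {P : Module.End K W} (hPP : P * P = P) (Y : Module.End K W) :
    Y ∈ Module.End.eigenspace (LinearMap.mulLeft K P - LinearMap.mulRight K P) (-1) ↔ (1 - P) * Y * P = Y := by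
  have nf : ∀ X : Module.End K W, P * (P * X) = P * X := fun X => by rw [← mul_assoc, hPP]
  rw [Module.End.mem_eigenspace_iff, adP_apply, neg_one_smul]
  constructor
  · intro h
    have h1 : P * (Y * P) = 0 := by
      have h' := congrArg (fun T => P * T * P) h
      simp only [mul_sub, sub_mul, mul_assoc, hPP, nf, sub_self, mul_neg, neg_mul, zero_eq_neg] at h'
      exact h'
    have h2 : P * Y = 0 := by
      have h' := congrArg (fun T => P * T) h
      simp only [mul_sub, nf, h1, sub_zero, mul_neg] at h'
      -- h' : P * Y = -(P * Y)
      have h'' : (2 : K) • (P * Y) = 0 := by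
        rw [two_smul]; nth_rw 2 [h']; rw [add_neg_cancel]
      exact (smul_eq_zero.1 h'').resolve_left two_ne_zero
    have h3 : Y * P = Y := by
      have h' : P * Y - Y * P = -Y := h
      rw [h2, zero_sub, neg_inj] at h'
      exact h'
    rw [sub_mul, one_mul, sub_mul, h3, mul_assoc, h3, h2, sub_zero]
  · intro h
    rw [← h]
    simp only [mul_sub, sub_mul, one_mul, mul_assoc, hPP, nf]
    abel

omit [CharZero K] in
/-- **`Y ∈ Eig₀(ad P) ↔ P Y = Y P`**. [cite: Deligne1982HodgeCycles, I §3 (proof of Prop. 3.4)] -/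
theorem mem_eigenspace_adP_zero_iff (P Y : Module.End K W) :
    Y ∈ Module.End.eigenspace (LinearMap.mulLeft K P - LinearMap.mulRight K P) 0 ↔ P * Y = Y * P := by
  rw [Module.End.mem_eigenspace_iff, adP_apply, zero_smul, sub_eq_zero]

omit [CharZero K] in
/-- `P Y = Y P` iff `Y` is block diagonal: `P Y P + (1 − P) Y (1 − P) = Y` (`P² = P`).
[cite: Deligne1982HodgeCycles, I §3 (proof of Prop. 3.4)] -/
theorem commute_iff_blocks {P : Module.End K W} (hPP : P * P = P) (Y : Module.End K W) :
    P * Y = Y * P ↔ P * Y * P + (1 - P) * Y * (1 - P) = Y := by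
  have nf : ∀ X : Module.End K W, P * (P * X) = P * X := fun X => by rw [← mul_assoc, hPP]
  constructor
  · intro h
    simp only [mul_sub, sub_mul, mul_one, one_mul, mul_assoc, h, hPP]
    abel
  · intro h
    have h1 : P * Y = P * (Y * P) := by
      have h' := congrArg (fun T => P * T) h
      simp only [mul_add, mul_sub, sub_mul, mul_one, one_mul, mul_assoc, nf, sub_self, add_zero] at h'
      exact h'.symm
    have h2 : Y * P = P * (Y * P) := by
      have h' := congrArg (fun T => T * P) h
      simp only [add_mul, mul_sub, sub_mul, mul_one, one_mul, mul_assoc, hPP, sub_self, add_zero] at h'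
      exact h'.symm
    rw [h1, ← h2]

/-- The three components `P Y (1−P) ∈ Eig₁`, `(1−P) Y P ∈ Eig₋₁`, `P Y P + (1−P) Y (1−P) ∈ Eig₀` of any `Y`, and
`Y` is their sum (`P² = P`). [cite: Deligne1982HodgeCycles, I §3 (proof of Prop. 3.4)] -/
theorem components_mem_eigenspace_adP {P : Module.End K W} (hPP : P * P = P) (Y : Module.End K W) :
    P * Y * (1 - P) ∈ Module.End.eigenspace (LinearMap.mulLeft K P - LinearMap.mulRight K P) 1 ∧
      (1 - P) * Y * P ∈ Module.End.eigenspace (LinearMap.mulLeft K P - LinearMap.mulRight K P) (-1) ∧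
      P * Y * P + (1 - P) * Y * (1 - P) ∈
        Module.End.eigenspace (LinearMap.mulLeft K P - LinearMap.mulRight K P) 0 ∧
      P * Y * (1 - P) + (1 - P) * Y * P + (P * Y * P + (1 - P) * Y * (1 - P)) = Y := by
  have nf : ∀ X : Module.End K W, P * (P * X) = P * X := fun X => by rw [← mul_assoc, hPP]
  refine ⟨?_, ?_, ?_, ?_⟩
  · rw [mem_eigenspace_adP_one_iff hPP]
    simp only [mul_sub, sub_mul, mul_one, mul_assoc, hPP, nf]
    abel
  · rw [mem_eigenspace_adP_neg_one_iff hPP]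
    simp only [mul_sub, sub_mul, one_mul, mul_assoc, hPP, nf]
    abel
  · rw [mem_eigenspace_adP_zero_iff]
    simp only [mul_add, add_mul, mul_sub, sub_mul, mul_one, one_mul, mul_assoc, hPP, nf]
    abel
  · simp only [mul_sub, sub_mul, mul_one, one_mul, mul_assoc]
    abel

omit [CharZero K] in
/-- **`Eig₁ · Eig₁ = 0`**: `E E' = 0` for `E = P E (1−P)`, `E' = P E' (1−P)` (`P² = P`).
[cite: Deligne1982HodgeCycles, I §3 (proof of Prop. 3.4)] -/
theorem mul_eq_zero_of_plus_plus {P E E' : Module.End K W} (hPP : P * P = P) (hE : P * E * (1 - P) = E)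
    (hE' : P * E' * (1 - P) = E') : E * E' = 0 := by
  have nf : ∀ X : Module.End K W, P * (P * X) = P * X := fun X => by rw [← mul_assoc, hPP]
  rw [← hE, ← hE']
  simp only [mul_sub, sub_mul, mul_one, mul_assoc, nf]
  abel

omit [CharZero K] in
/-- **`Eig₋₁ · Eig₋₁ = 0`**: `F F' = 0` for `F = (1−P) F P`, `F' = (1−P) F' P`.
[cite: Deligne1982HodgeCycles, I §3 (proof of Prop. 3.4)] -/
theorem mul_eq_zero_of_minus_minus {P F F' : Module.End K W} (hPP : P * P = P) (hF : (1 - P) * F * P = F)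
    (hF' : (1 - P) * F' * P = F') : F * F' = 0 := by
  have nf : ∀ X : Module.End K W, P * (P * X) = P * X := fun X => by rw [← mul_assoc, hPP]
  rw [← hF, ← hF']
  simp only [mul_sub, sub_mul, one_mul, mul_assoc, nf]
  abel

omit [CharZero K] in
/-- Corner identities of `E ∈ Eig₁`, `F ∈ Eig₋₁`: `PE = E`, `EP = 0`, `E(1−P) = E`, `PF = 0`, `FP = F`, `(1−P)F = F`.
[cite: Deligne1982HodgeCycles, I §3 (proof of Prop. 3.4)] -/
theorem corner_identities {P E F : Module.End K W} (hPP : P * P = P) (hE : P * E * (1 - P) = E)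
    (hF : (1 - P) * F * P = F) :
    P * E = E ∧ E * P = 0 ∧ E * (1 - P) = E ∧ P * F = 0 ∧ F * P = F ∧ (1 - P) * F = F := by
  have nf : ∀ X : Module.End K W, P * (P * X) = P * X := fun X => by rw [← mul_assoc, hPP]
  have hPE : P * E = E := by
    calc P * E = P * (P * E * (1 - P)) := by rw [hE]
      _ = P * E * (1 - P) := by simp only [mul_sub, mul_one, mul_assoc, nf]
      _ = E := hE
  have hEP : E * P = 0 := by
    calc E * P = P * E * (1 - P) * P := by rw [hE]
      _ = 0 := by simp only [mul_sub, sub_mul, mul_one, mul_assoc, hPP, sub_self]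
  have hPF : P * F = 0 := by
    calc P * F = P * ((1 - P) * F * P) := by rw [hF]
      _ = 0 := by simp only [mul_sub, sub_mul, one_mul, mul_assoc, nf, sub_self]
  have hFP : F * P = F := by
    calc F * P = (1 - P) * F * P * P := by rw [hF]
      _ = (1 - P) * F * P := by simp only [mul_assoc, hPP]
      _ = F := hF
  refine ⟨hPE, hEP, ?_, hPF, hFP, ?_⟩
  · rw [mul_sub, mul_one, hEP, sub_zero]
  · rw [sub_mul, one_mul, hPF, sub_zero]

omit [CharZero K] in
/-- **`E F` and `F E` commute with `P`** for `E ∈ Eig₁`, `F ∈ Eig₋₁`; so `E F ± F E ∈ Eig₀`.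
[cite: Deligne1982HodgeCycles, I §3 (proof of Prop. 3.4)] -/
theorem mul_plus_minus_comm {P E F : Module.End K W} (hPP : P * P = P) (hE : P * E * (1 - P) = E)
    (hF : (1 - P) * F * P = F) :
    P * (E * F) = E * F ∧ E * F * P = E * F ∧ P * (F * E) = 0 ∧ F * E * P = 0 ∧
      P * (E * F - F * E) = (E * F - F * E) * P ∧ P * (E * F + F * E) = (E * F + F * E) * P := by
  obtain ⟨hPE, hEP, -, hPF, hFP, -⟩ := corner_identities hPP hE hF
  have h1 : P * (E * F) = E * F := by rw [← mul_assoc, hPE]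
  have h2 : E * F * P = E * F := by rw [mul_assoc, hFP]
  have h3 : P * (F * E) = 0 := by rw [← mul_assoc, hPF, zero_mul]
  have h4 : F * E * P = 0 := by rw [mul_assoc, hEP, mul_zero]
  refine ⟨h1, h2, h3, h4, ?_, ?_⟩
  · rw [mul_sub, sub_mul, h1, h2, h3, h4]
  · rw [mul_add, add_mul, h1, h2, h3, h4]

omit [CharZero K] in
/-- **A `P`-corner equal to a `(1−P)`-corner vanishes**: if `E ∈ Eig₁` and `F ∈ Eig₋₁` COMMUTE then
`E F = 0 = F E`. [cite: Deligne1982HodgeCycles, I §3 (proof of Prop. 3.4)] -/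
theorem mul_eq_zero_of_commute_plus_minus {P E F : Module.End K W} (hPP : P * P = P) (hE : P * E * (1 - P) = E)
    (hF : (1 - P) * F * P = F) (h : E * F = F * E) : E * F = 0 ∧ F * E = 0 := by
  obtain ⟨h1, -, h3, -⟩ := mul_plus_minus_comm hPP hE hF
  have hEF : E * F = 0 := by rw [← h1, h, h3]
  exact ⟨hEF, by rw [← h, hEF]⟩

omit [CharZero K] in
/-- **`Eig₀ · Eig₁ ⊆ Eig₁ ⊇ Eig₁ · Eig₀`** and the same for `Eig₋₁`: for `Z` commuting with `P`, `Z E`, `E Z ∈ Eig₁`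
and `Z F`, `F Z ∈ Eig₋₁`. [cite: Deligne1982HodgeCycles, I §3 (proof of Prop. 3.4)] -/
theorem zero_mul_plus {P Z E F : Module.End K W} (hPP : P * P = P) (hZ : P * Z = Z * P)
    (hE : P * E * (1 - P) = E) (hF : (1 - P) * F * P = F) :
    P * (Z * E) * (1 - P) = Z * E ∧ P * (E * Z) * (1 - P) = E * Z ∧
      (1 - P) * (Z * F) * P = Z * F ∧ (1 - P) * (F * Z) * P = F * Z := by
  obtain ⟨hPE, -, hEQ, -, hFP, hQF⟩ := corner_identities hPP hE hF
  have hZQ : (1 - P) * Z = Z * (1 - P) := by rw [sub_mul, mul_sub, one_mul, mul_one, hZ]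
  refine ⟨?_, ?_, ?_, ?_⟩
  · rw [← mul_assoc, hZ, mul_assoc Z P E, hPE, mul_assoc, hEQ]
  · rw [← mul_assoc, hPE, mul_assoc, ← hZQ, ← mul_assoc, hEQ]
  · rw [← mul_assoc, hZQ, mul_assoc Z (1 - P) F, hQF, mul_assoc, hFP]
  · rw [← mul_assoc, hQF, mul_assoc, ← hZ, ← mul_assoc, hFP]

end Generic

/-! ## §2 The grading of `𝔤 = 𝔥_ℂ` and the dimension count -/

variable {V : Type u} [AddCommGroup V] [Module ℚ V] [Module.Finite ℚ V] [HodgeTensorFacts.{u, u}] {n : ℤ}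
  {S : Type u} [Fintype S] [DecidableEq S] {deg : S → ℤ}

/-- **For `Y ∈ 𝔤` the three components `P Y (1−P)`, `(1−P) Y P`, `P Y P + (1−P) Y (1−P)` lie in `𝔤`**
(degrees in `{0,1}`; `projE_mem_hodgeLieC` and subtraction). [cite: Deligne1982HodgeCycles, I §3 (proof of Prop. 3.4)] -/
theorem hodgeLieC_components_mem (H : HodgeStructure V n) (e : Module.Basis S ℂ (ℂ ⊗[ℚ] V))
    (hF : ∀ a, H.F a = Submodule.span ℂ (e '' {σ | a ≤ deg σ}))
    (hFc : ∀ a, complexConj (H.F a) = Submodule.span ℂ (e '' {σ | deg σ ≤ n - a}))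
    (hdeg : ∀ σ, deg σ = 0 ∨ deg σ = 1) {Y : Module.End ℂ (ℂ ⊗[ℚ] V)} (hY : Y ∈ H.hodgeLieC) :
    gradingEnd e deg * Y * (1 - gradingEnd e deg) ∈ H.hodgeLieC ∧
      (1 - gradingEnd e deg) * Y * gradingEnd e deg ∈ H.hodgeLieC ∧
      gradingEnd e deg * Y * gradingEnd e deg + (1 - gradingEnd e deg) * Y * (1 - gradingEnd e deg) ∈
        H.hodgeLieC := by
  obtain ⟨hE, hF'⟩ := projE_mem_hodgeLieC H e hF hFc hdeg hY
  refine ⟨hE, hF', ?_⟩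
  have h' : gradingEnd e deg * Y * gradingEnd e deg + (1 - gradingEnd e deg) * Y * (1 - gradingEnd e deg) =
      Y - gradingEnd e deg * Y * (1 - gradingEnd e deg) - (1 - gradingEnd e deg) * Y * gradingEnd e deg := by
    simp only [mul_sub, sub_mul, mul_one, one_mul, mul_assoc]
    abel
  rw [h']
  exact H.hodgeLieC.sub_mem (H.hodgeLieC.sub_mem hY hE) hF'

/-- **`𝔤 = 𝔤⁺ ⊔ 𝔤⁻ ⊔ 𝔤⁰`, `𝔤⁺ ⊓ 𝔤⁻ = 0`, `(𝔤⁺ ⊔ 𝔤⁻) ⊓ 𝔤⁰ = 0`** (the grading is a direct sum decomposition).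
[cite: Deligne1982HodgeCycles, I §3 (proof of Prop. 3.4)] -/
theorem grading_sup_inf (H : HodgeStructure V n) (e : Module.Basis S ℂ (ℂ ⊗[ℚ] V))
    (hF : ∀ a, H.F a = Submodule.span ℂ (e '' {σ | a ≤ deg σ}))
    (hFc : ∀ a, complexConj (H.F a) = Submodule.span ℂ (e '' {σ | deg σ ≤ n - a}))
    (hdeg : ∀ σ, deg σ = 0 ∨ deg σ = 1) :
    (H.hodgeLieC ⊓ Module.End.eigenspace
        (LinearMap.mulLeft ℂ (gradingEnd e deg) - LinearMap.mulRight ℂ (gradingEnd e deg)) 1) ⊔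
      (H.hodgeLieC ⊓ Module.End.eigenspace
        (LinearMap.mulLeft ℂ (gradingEnd e deg) - LinearMap.mulRight ℂ (gradingEnd e deg)) (-1)) ⊔
      (H.hodgeLieC ⊓ Module.End.eigenspace
        (LinearMap.mulLeft ℂ (gradingEnd e deg) - LinearMap.mulRight ℂ (gradingEnd e deg)) 0) = H.hodgeLieC ∧
    (H.hodgeLieC ⊓ Module.End.eigenspace
        (LinearMap.mulLeft ℂ (gradingEnd e deg) - LinearMap.mulRight ℂ (gradingEnd e deg)) 1) ⊓
      (H.hodgeLieC ⊓ Module.End.eigenspace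
        (LinearMap.mulLeft ℂ (gradingEnd e deg) - LinearMap.mulRight ℂ (gradingEnd e deg)) (-1)) = ⊥ ∧
    ((H.hodgeLieC ⊓ Module.End.eigenspace
        (LinearMap.mulLeft ℂ (gradingEnd e deg) - LinearMap.mulRight ℂ (gradingEnd e deg)) 1) ⊔
      (H.hodgeLieC ⊓ Module.End.eigenspace
        (LinearMap.mulLeft ℂ (gradingEnd e deg) - LinearMap.mulRight ℂ (gradingEnd e deg)) (-1))) ⊓
      (H.hodgeLieC ⊓ Module.End.eigenspace
        (LinearMap.mulLeft ℂ (gradingEnd e deg) - LinearMap.mulRight ℂ (gradingEnd e deg)) 0) = ⊥ := by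
  have hPP := gradingEnd_mul_gradingEnd_of_deg e hdeg
  set P := gradingEnd e deg with hP
  have nf : ∀ X : Module.End ℂ (ℂ ⊗[ℚ] V), P * (P * X) = P * X := fun X => by rw [← mul_assoc, hPP]
  refine ⟨?_, ?_, ?_⟩
  · apply le_antisymm
    · exact sup_le (sup_le inf_le_left inf_le_left) inf_le_left
    · intro Y hY
      obtain ⟨h1, h2, h3, hsum⟩ := components_mem_eigenspace_adP (K := ℂ) hPP Y
      obtain ⟨g1, g2, g3⟩ := hodgeLieC_components_mem H e hF hFc hdeg hY
      rw [← hsum]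
      exact Submodule.add_mem _
        (Submodule.mem_sup_left (Submodule.add_mem _ (Submodule.mem_sup_left ⟨g1, h1⟩)
          (Submodule.mem_sup_right ⟨g2, h2⟩)))
        (Submodule.mem_sup_right ⟨g3, h3⟩)
  · rw [eq_bot_iff]
    rintro Y ⟨⟨-, h1⟩, ⟨-, h2⟩⟩
    rw [SetLike.mem_coe, mem_eigenspace_adP_one_iff hPP] at h1
    rw [SetLike.mem_coe, mem_eigenspace_adP_neg_one_iff hPP] at h2
    rw [Submodule.mem_bot]
    calc Y = P * Y * (1 - P) := h1.symm
      _ = P * ((1 - P) * Y * P) * (1 - P) := by rw [h2]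
      _ = 0 := by simp only [mul_sub, sub_mul, mul_one, one_mul, mul_assoc, hPP, nf]; abel
  · rw [eq_bot_iff]
    rintro Y ⟨h12, ⟨-, h3⟩⟩
    rw [SetLike.mem_coe, Submodule.mem_sup] at h12
    obtain ⟨E, ⟨-, hE⟩, F, ⟨-, hF'⟩, rfl⟩ := h12
    rw [SetLike.mem_coe, mem_eigenspace_adP_one_iff hPP] at hE
    rw [SetLike.mem_coe, mem_eigenspace_adP_neg_one_iff hPP] at hF'
    rw [SetLike.mem_coe, mem_eigenspace_adP_zero_iff, commute_iff_blocks hPP] at h3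
    rw [Submodule.mem_bot, ← h3, ← hE, ← hF']
    simp only [mul_add, add_mul, mul_sub, sub_mul, mul_one, one_mul, mul_assoc, hPP, nf]
    abel

/-- **`dim 𝔤 = dim 𝔤⁺ + dim 𝔤⁻ + dim 𝔤⁰`** for the `ad(2P−1)`-grading of `𝔤 = 𝔥_ℂ` (weight one, degrees in `{0,1}`).
[cite: Deligne1982HodgeCycles, I §3 (proof of Prop. 3.4)] [cite: Huybrechts2016K3, §3.3.4 (p. 66)] -/
theorem finrank_hodgeLieC_eq_grading (H : HodgeStructure V n) (e : Module.Basis S ℂ (ℂ ⊗[ℚ] V))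
    (hF : ∀ a, H.F a = Submodule.span ℂ (e '' {σ | a ≤ deg σ}))
    (hFc : ∀ a, complexConj (H.F a) = Submodule.span ℂ (e '' {σ | deg σ ≤ n - a}))
    (hdeg : ∀ σ, deg σ = 0 ∨ deg σ = 1) :
    Module.finrank ℂ H.hodgeLieC =
      Module.finrank ℂ (H.hodgeLieC ⊓ Module.End.eigenspace
          (LinearMap.mulLeft ℂ (gradingEnd e deg) - LinearMap.mulRight ℂ (gradingEnd e deg)) 1 :
            Submodule ℂ _) +
        Module.finrank ℂ (H.hodgeLieC ⊓ Module.End.eigenspace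
          (LinearMap.mulLeft ℂ (gradingEnd e deg) - LinearMap.mulRight ℂ (gradingEnd e deg)) (-1) :
            Submodule ℂ _) +
        Module.finrank ℂ (H.hodgeLieC ⊓ Module.End.eigenspace
          (LinearMap.mulLeft ℂ (gradingEnd e deg) - LinearMap.mulRight ℂ (gradingEnd e deg)) 0 :
            Submodule ℂ _) := by
  obtain ⟨hsup, hinf1, hinf2⟩ := grading_sup_inf H e hF hFc hdeg
  set Gp := H.hodgeLieC ⊓ Module.End.eigenspace
      (LinearMap.mulLeft ℂ (gradingEnd e deg) - LinearMap.mulRight ℂ (gradingEnd e deg)) 1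
  set Gm := H.hodgeLieC ⊓ Module.End.eigenspace
      (LinearMap.mulLeft ℂ (gradingEnd e deg) - LinearMap.mulRight ℂ (gradingEnd e deg)) (-1)
  set G0 := H.hodgeLieC ⊓ Module.End.eigenspace
      (LinearMap.mulLeft ℂ (gradingEnd e deg) - LinearMap.mulRight ℂ (gradingEnd e deg)) 0
  have h1 := Submodule.finrank_sup_add_finrank_inf_eq Gp Gm
  rw [hinf1, finrank_bot, add_zero] at h1
  have h2 := Submodule.finrank_sup_add_finrank_inf_eq (Gp ⊔ Gm) G0
  rw [hinf2, finrank_bot, add_zero, hsup, h1] at h2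
  exact h2

end HodgeStructure

end Literature.AlgebraicGeometry.Motives

end
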